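import Mathlib
import Summits.NavierStokesRegularity.NavierStokesRegularity.Theorems.SubOnsagerCeilingKPSharedPocketStarvation
import Summits.NavierStokesRegularity.NavierStokesRegularity.Theorems.SubOnsagerCeilingKPBarrierCurrency
import Summits.NavierStokesRegularity.NavierStokesRegularity.Theorems.SubcriticalEnvelopeForwardSourceTailEnvelopeKPDyadicRatioTwo
import HarnessLib

/-!
# STARVED NETWORKS WITH A SHARED DEAD-END POCKET — the starved gate fluxes and the ν-uniform shell barrier (part 2 of 2)
# (helper file for the crux `SubOnsagerCeiling.ForwardTailCeilingKP`, stmt-NavierStokesRegularity-27057, `--supports`)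

Sequel of `Theorems/SubOnsagerCeilingKPSharedPocketStarvation.lean` (the SHARED-POCKET class: live modes `0,1,2` with an arbitrary
diagonal forward network `w_{ae} = α a a e (0,0,1)`, all pumping in-shell into the common dead-end pocket `3` with weights `P a`,
`P 3 = 0`; the comparison `ρ·x_{e,N+1} ≤ x_{3,N}` for `ρ·w_{ae} ≤ P a`).  With the second strength hypothesis `κ·Σ_e w_{ae} ≤ P a`:

* `sharedPocket_flux_step` — the SHELL energy identity (`kpProper_shellEnergy_identity`: in-gate − out-gate) minus the pocket's own
  balance gives «out-gate work + pump work ≤ in-gate work» for the live block of every shell `n ≥ 1`, and pump work `≥ ρκ ×` out-gate work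
  pointwise; hence `(1 + ρκ)·OUT_{m+1} ≤ OUT_m` for the class-wide gate fluxes `OUT_m(t) = ∫₀ᵗ Λ_m Σ_{i,j} w_{ij} x²_{i,m} x_{j,m+1}`;
* `sharedPocket_flux_le` — `OUT_m(t) ≤ E₀·q^m`, `q = (1 + ρκ)⁻¹`;
* `sharedPocket_shellBarrierAt` — `ShellBarrierAt R ε₀ α` with `(1+ε₀)^{2θ} = 1 + ρκ`, `D = 1 + ρκ`, at EVERY scale ratio when `ρκ > ε₀`:
  chains, re-entry pairs, 3-cycles, fans and merging networks on the live modes are ALL covered once every live mode has a strong enough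
  exit into the shared pocket — the class-wide form of the energy-starvation corners;
* `sharedPocket_ceilingAt`, `sharedPocket_primaryGraded` — the same in the currencies `CeilingAt` and the skeleton's `PrimaryGradedAt` body.

HONEST FRAMING: statements about Tao-type MODEL lattice ODEs (route SubOnsagerCeiling, rung TL-M2Break); one architecture class (shared
pocket, strong exits); no stub, crux or summit is proved and nothing here bears on Navier–Stokes regularity.
[cite: Tao2016AveragedNS, §4 (4.2)–(4.3), (4.8)–(4.9), (4.13)]
-/

noncomputable section

-- the sub-problem namespace `NavierStokesRegularity.NavierStokesRegularity` is the tree's layout (D-0017)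
set_option linter.dupNamespace false

namespace Summit.NavierStokesRegularity.NavierStokesRegularity.Theorems

open Set Finset MeasureTheory intervalIntegral
open scoped Topology
open Literature.Analysis.FluidPDE.TaoCascade
open Summit.NavierStokesRegularity.NavierStokesRegularity.Theorems.SubOnsagerCeiling

section SharedPocketFlux

variable {α : Fin 4 → Fin 4 → Fin 4 → ℤ × ℤ × ℤ → ℝ} {P : Fin 4 → ℝ}
  (hs : IsSymmetricCoeff α) (hc : IsCancellingCoeff α)
  (hO : ∀ (Y : Fin 4 → ℤ → ℝ → ℝ) (τ : ℝ), (∀ (j : Fin 4) (k : ℤ), 1 ≤ k → 0 ≤ Y j k τ) →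
    ∀ δ : ℝ, 0 < δ → ∀ (i : Fin 4) (n : ℤ), 1 ≤ n → Y i n τ = 0 → 0 ≤ quadTerm δ α Y i n τ)
  (hD : ∀ a b i : Fin 4, a ≠ b → α a b i (0, 0, 1) = 0)
  (hw3 : ∀ a : Fin 4, α a a 3 (0, 0, 1) = 0) (h3w : ∀ e : Fin 4, α 3 3 e (0, 0, 1) = 0)
  (hPump : ∀ a d : Fin 4, a ≠ d → α a a d (0, 0, 0) = if d = 3 then P a else 0) (hP33 : P 3 = 0)
  (hCz : ∀ a b d : Fin 4, a ≠ b → a ≠ d → b ≠ d → α a b d (0, 0, 0) = 0)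
include hs hc hO hD hw3 h3w hPump hP33 hCz

/-- **Starvation of the gate fluxes, one step**: `(1 + ρκ)·OUT_{m+1}(t) ≤ OUT_m(t)` along every honest non-negative `ν`-viscous solution from
a one-shell datum (`ν ≥ 0`, `ε₀ ≥ 0`, `P ≥ 0`, `ρ, κ ≥ 0`, `ρ w_{ae} ≤ P a`, `κ Σ_e w_{ae} ≤ P a`). [cite: Tao2016AveragedNS, §4 (4.8)–(4.9), (4.13)] -/
theorem sharedPocket_flux_step {ε₀ ν s ρ κ : ℝ} (hε : 0 ≤ ε₀) (hν : 0 ≤ ν) (hρ0 : 0 ≤ ρ) (hκ0 : 0 ≤ κ) (hPnn : ∀ a, 0 ≤ P a)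
    (hρ : ∀ a e : Fin 4, ρ * α a a e (0, 0, 1) ≤ P a) (hκ : ∀ a : Fin 4, κ * ∑ e, α a a e (0, 0, 1) ≤ P a)
    {X₀ : Fin 4 → ℝ} {X : Fin 4 → ℤ → ℝ → ℝ}
    (hdat : ∀ (i : Fin 4) (k : ℤ), X i k 0 = if k = 0 then X₀ i else 0)
    (hXc : ∀ (i : Fin 4) (k : ℤ), Continuous (X i k))
    (hode : ∀ (i : Fin 4) (k : ℤ), ∀ t ∈ Icc (0 : ℝ) s, HasDerivWithinAt (X i k)
      (quadTerm ε₀ α X i k t - ν * (1 + ε₀) ^ ((2 : ℝ) * k) * X i k t) (Icc (0 : ℝ) s) t)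
    (hnn : ∀ t ∈ Icc (0 : ℝ) s, ∀ (i : Fin 4) (k : ℤ), 1 ≤ k → 0 ≤ X i k t) {n : ℤ} (hn : 1 ≤ n) :
    ∀ t ∈ Icc (0 : ℝ) s,
      (1 + ρ * κ) * ∫ τ in (0 : ℝ)..t, (1 + ε₀) ^ ((5 : ℝ) * n / 2) *
          ∑ i, ∑ j, α i i j (0, 0, 1) * X i n τ ^ 2 * X j (n + 1) τ ≤
        ∫ τ in (0 : ℝ)..t, (1 + ε₀) ^ ((5 : ℝ) * ((n : ℝ) - 1) / 2) *
          ∑ i, ∑ a, α a a i (0, 0, 1) * X a (n - 1) τ ^ 2 * X i n τ := by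
  have hb : (0 : ℝ) < 1 + ε₀ := by linarith
  have hw0 : ∀ a i : Fin 4, 0 ≤ α a a i (0, 0, 1) := fun a i => kpProper_feed_nonneg hO a i
  set Λn : ℝ := (1 + ε₀) ^ ((5 : ℝ) * n / 2) with hΛn
  set Λm : ℝ := (1 + ε₀) ^ ((5 : ℝ) * ((n : ℝ) - 1) / 2) with hΛm
  set ν' : ℝ := ν * (1 + ε₀) ^ ((2 : ℝ) * n) with hν'
  have hΛn0 : 0 ≤ Λn := by positivity
  have hν'0 : 0 ≤ ν' := by positivity
  set IN : ℝ → ℝ := fun τ => Λm * ∑ i, ∑ a, α a a i (0, 0, 1) * X a (n - 1) τ ^ 2 * X i n τ with hIN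
  set OUT : ℝ → ℝ := fun τ => Λn * ∑ i, ∑ j, α i i j (0, 0, 1) * X i n τ ^ 2 * X j (n + 1) τ with hOUT
  set PUMP : ℝ → ℝ := fun τ => Λn * (X 3 n τ * ∑ a, P a * X a n τ ^ 2) with hPUMP
  set DISS : ℝ → ℝ := fun τ => ν' * (X 0 n τ ^ 2 + X 1 n τ ^ 2 + X 2 n τ ^ 2) with hDISS
  have hINc : Continuous IN := continuous_const.mul (continuous_finsetSum _ fun i _ => continuous_finsetSum _ fun a _ =>
    (continuous_const.mul ((hXc a _).pow 2)).mul (hXc i _))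
  have hOUTc : Continuous OUT := continuous_const.mul (continuous_finsetSum _ fun i _ => continuous_finsetSum _ fun j _ =>
    (continuous_const.mul ((hXc i _).pow 2)).mul (hXc j _))
  have hPUMPc : Continuous PUMP := continuous_const.mul ((hXc 3 _).mul (continuous_finsetSum _ fun a _ =>
    continuous_const.mul ((hXc a _).pow 2)))
  have hDISSc : Continuous DISS := continuous_const.mul ((((hXc 0 _).pow 2).add ((hXc 1 _).pow 2)).add ((hXc 2 _).pow 2))
  -- the live energy of shell `n` and its balance
  set L : ℝ → ℝ := fun τ => (1 / 2 : ℝ) * X 0 n τ ^ 2 + (1 / 2 : ℝ) * X 1 n τ ^ 2 + (1 / 2 : ℝ) * X 2 n τ ^ 2 with hL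
  set G : ℝ → ℝ := fun τ => L τ - (∫ u in (0 : ℝ)..τ, IN u) + (∫ u in (0 : ℝ)..τ, OUT u) + (∫ u in (0 : ℝ)..τ, PUMP u) +
    ∫ u in (0 : ℝ)..τ, DISS u with hG
  have hprim : ∀ {f : ℝ → ℝ}, Continuous f → ∀ τ : ℝ,
      HasDerivWithinAt (fun u => ∫ v in (0 : ℝ)..u, f v) (f τ) (Icc 0 s) τ := by
    intro f hf τ
    exact (intervalIntegral.integral_hasDerivAt_right (hf.intervalIntegrable _ _)
      (hf.stronglyMeasurableAtFilter _ _) hf.continuousAt).hasDerivWithinAt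
  have hGd : ∀ τ ∈ Icc (0 : ℝ) s, HasDerivWithinAt G 0 (Icc 0 s) τ := by
    intro τ hτ
    have hsq : ∀ i : Fin 4, HasDerivWithinAt (fun u => (1 / 2 : ℝ) * X i n u ^ 2)
        ((1 / 2 : ℝ) * (((2 : ℕ) : ℝ) * X i n τ ^ (2 - 1) *
          (quadTerm ε₀ α X i n τ - ν * (1 + ε₀) ^ ((2 : ℝ) * n) * X i n τ))) (Icc 0 s) τ :=
      fun i => ((hode i n τ hτ).pow 2).const_mul (1 / 2)
    have hLd : HasDerivWithinAt L
        ((1 / 2 : ℝ) * (((2 : ℕ) : ℝ) * X 0 n τ ^ (2 - 1) * (quadTerm ε₀ α X 0 n τ - ν * (1 + ε₀) ^ ((2 : ℝ) * n) * X 0 n τ)) +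
          (1 / 2 : ℝ) * (((2 : ℕ) : ℝ) * X 1 n τ ^ (2 - 1) * (quadTerm ε₀ α X 1 n τ - ν * (1 + ε₀) ^ ((2 : ℝ) * n) * X 1 n τ)) +
          (1 / 2 : ℝ) * (((2 : ℕ) : ℝ) * X 2 n τ ^ (2 - 1) * (quadTerm ε₀ α X 2 n τ - ν * (1 + ε₀) ^ ((2 : ℝ) * n) * X 2 n τ)))
        (Icc 0 s) τ := ((hsq 0).add (hsq 1)).add (hsq 2)
    have h := ((((hLd.sub (hprim hINc τ)).add (hprim hOUTc τ)).add (hprim hPUMPc τ)).add (hprim hDISSc τ))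
    refine h.congr_deriv ?_
    -- the shell identity: Σ_i x_i·quadTerm_i = IN − OUT, and the pocket's own term
    have hshell := kpProper_shellEnergy_identity hs hc hO hD ε₀ X n τ
    rw [Fin.sum_univ_four] at hshell
    have hpocket : X 3 n τ * quadTerm ε₀ α X 3 n τ = PUMP τ := by
      rw [sharedPocket_quadTerm_pocket hs hc hO hD hw3 h3w hPump hP33 hCz]
      simp only [hPUMP]
      ring
    simp only [hIN, hOUT, hDISS] at hshell ⊢
    push_cast
    have e3 : quadTerm ε₀ α X 0 n τ * X 0 n τ + quadTerm ε₀ α X 1 n τ * X 1 n τ + quadTerm ε₀ α X 2 n τ * X 2 n τ =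
        (Λm * ∑ i, ∑ a, α a a i (0, 0, 1) * X a (n - 1) τ ^ 2 * X i n τ -
          Λn * ∑ i, ∑ j, α i i j (0, 0, 1) * X i n τ ^ 2 * X j (n + 1) τ) - PUMP τ := by
      rw [← hpocket]
      simp only [hΛm, hΛn]
      linarith [hshell]
    linear_combination e3
  have hGc : ContinuousOn G (Icc 0 s) := fun τ hτ => (hGd τ hτ).continuousWithinAt
  have hGd' : ∀ u ∈ Ico (0 : ℝ) s, HasDerivWithinAt G 0 (Ici u) u := fun u hu =>
    (hGd u (Ico_subset_Icc_self hu)).mono_of_mem_nhdsWithin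
      (Filter.mem_of_superset (Icc_mem_nhdsGE hu.2) (Icc_subset_Icc hu.1 le_rfl))
  have hG0 : G 0 = 0 := by
    have h0 : ∀ i : Fin 4, X i n 0 = 0 := fun i => by rw [hdat]; simp; omega
    simp [hG, hL, h0]
  intro t ht
  have hGt : G t = 0 := by
    have h := constant_of_has_deriv_right_zero hGc hGd' t ht
    rw [hG0] at h
    exact h
  have hV : 0 ≤ ∫ u in (0 : ℝ)..t, DISS u :=
    intervalIntegral.integral_nonneg ht.1 fun u _ => mul_nonneg hν'0 (by positivity)
  have hE : 0 ≤ L t := by positivity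
  -- pump work ≥ ρκ × out-gate work
  have hdom : ρ * κ * (∫ u in (0 : ℝ)..t, OUT u) ≤ ∫ u in (0 : ℝ)..t, PUMP u := by
    rw [← intervalIntegral.integral_const_mul]
    refine intervalIntegral.integral_mono_on ht.1 ((hOUTc.const_mul _).intervalIntegrable _ _)
      (hPUMPc.intervalIntegrable _ _) fun u hu => ?_
    have hus : u ∈ Icc (0 : ℝ) s := ⟨hu.1, hu.2.trans ht.2⟩
    have hx3 : 0 ≤ X 3 n u := hnn u hus 3 _ hn
    -- termwise: `ρ w_ij X_j(n+1) ≤ w_ij X_3(n)` (the pocket is not fed, so `j = 3` contributes nothing)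
    have hterm : ∀ i j : Fin 4, ρ * (α i i j (0, 0, 1) * X i n u ^ 2 * X j (n + 1) u) ≤
        α i i j (0, 0, 1) * X i n u ^ 2 * X 3 n u := by
      intro i j
      by_cases hj : j = 3
      · subst hj
        rw [hw3 i]
        simp
      · have hcmp := sharedPocket_pocket_ge hs hc hO hD hw3 h3w hPump hP33 hCz hε hν hρ0 hPnn hρ hdat hode hnn hj hn u hus
        have hfac : 0 ≤ α i i j (0, 0, 1) * X i n u ^ 2 := mul_nonneg (hw0 i j) (sq_nonneg _)
        nlinarith [mul_le_mul_of_nonneg_left hcmp hfac]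
    have hsum1 : ρ * ∑ i, ∑ j, α i i j (0, 0, 1) * X i n u ^ 2 * X j (n + 1) u ≤
        X 3 n u * ∑ i, (∑ j, α i i j (0, 0, 1)) * X i n u ^ 2 := by
      rw [Finset.mul_sum, Finset.mul_sum]
      refine Finset.sum_le_sum fun i _ => ?_
      rw [Finset.mul_sum, Finset.sum_mul, Finset.mul_sum]
      refine Finset.sum_le_sum fun j _ => ?_
      have := hterm i j
      nlinarith [this]
    have hsum2 : κ * ∑ i, (∑ j, α i i j (0, 0, 1)) * X i n u ^ 2 ≤ ∑ a, P a * X a n u ^ 2 := by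
      rw [Finset.mul_sum]
      refine Finset.sum_le_sum fun i _ => ?_
      have := mul_le_mul_of_nonneg_right (hκ i) (sq_nonneg (X i n u))
      nlinarith [this]
    simp only [hOUT, hPUMP]
    have h1 := mul_le_mul_of_nonneg_left hsum1 hκ0
    have h2 := mul_le_mul_of_nonneg_left hsum2 hx3
    have h3 : κ * (X 3 n u * ∑ i, (∑ j, α i i j (0, 0, 1)) * X i n u ^ 2) =
        X 3 n u * (κ * ∑ i, (∑ j, α i i j (0, 0, 1)) * X i n u ^ 2) := by ring
    have h4 : ρ * κ * (Λn * ∑ i, ∑ j, α i i j (0, 0, 1) * X i n u ^ 2 * X j (n + 1) u) =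
        Λn * (κ * (ρ * ∑ i, ∑ j, α i i j (0, 0, 1) * X i n u ^ 2 * X j (n + 1) u)) := by ring
    rw [h4]
    exact mul_le_mul_of_nonneg_left (by linarith [h1, h2, h3.symm.le, h3.le]) hΛn0
  have hsplit : (∫ u in (0 : ℝ)..t, OUT u) + (∫ u in (0 : ℝ)..t, PUMP u) ≤ ∫ u in (0 : ℝ)..t, IN u := by
    simp only [hG] at hGt
    linarith
  have key : (1 + ρ * κ) * (∫ u in (0 : ℝ)..t, OUT u) ≤ ∫ u in (0 : ℝ)..t, IN u :=
    calc (1 + ρ * κ) * (∫ u in (0 : ℝ)..t, OUT u)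
        = (∫ u in (0 : ℝ)..t, OUT u) + ρ * κ * (∫ u in (0 : ℝ)..t, OUT u) := by ring
      _ ≤ (∫ u in (0 : ℝ)..t, OUT u) + (∫ u in (0 : ℝ)..t, PUMP u) := by linarith [hdom]
      _ ≤ ∫ u in (0 : ℝ)..t, IN u := hsplit
  simpa only [hOUT, hIN] using key

/-- **Starvation of the gate fluxes**: `OUT_m(t) ≤ E₀·q^m`, `q = (1 + ρκ)⁻¹`, for every `m : ℕ` and `t ∈ [0,s]` (induction; base = the
class-wide flux budget `kpProper_bondFlux_budget`; the in-gate of shell `m+1` is the out-gate of shell `m`, `kpProper_outFlux_eq_inFlux_succ`).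
[cite: Tao2016AveragedNS, §4 (4.8)–(4.9), (4.13)] -/
theorem sharedPocket_flux_le {ε₀ ν s ρ κ : ℝ} (hε : 0 ≤ ε₀) (hν : 0 ≤ ν) (hρ0 : 0 ≤ ρ) (hκ0 : 0 ≤ κ) (hPnn : ∀ a, 0 ≤ P a)
    (hρ : ∀ a e : Fin 4, ρ * α a a e (0, 0, 1) ≤ P a) (hκ : ∀ a : Fin 4, κ * ∑ e, α a a e (0, 0, 1) ≤ P a)
    {X₀ : Fin 4 → ℝ} {X : Fin 4 → ℤ → ℝ → ℝ}
    (hdat : ∀ (i : Fin 4) (k : ℤ), X i k 0 = if k = 0 then X₀ i else 0)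
    (hvan : ∀ (i : Fin 4) (k : ℤ), k < 0 → ∀ t : ℝ, X i k t = 0)
    (hXc : ∀ (i : Fin 4) (k : ℤ), Continuous (X i k))
    (hode : ∀ (i : Fin 4) (k : ℤ), ∀ t ∈ Icc (0 : ℝ) s, HasDerivWithinAt (X i k)
      (quadTerm ε₀ α X i k t - ν * (1 + ε₀) ^ ((2 : ℝ) * k) * X i k t) (Icc (0 : ℝ) s) t)
    (hnn : ∀ t ∈ Icc (0 : ℝ) s, ∀ (i : Fin 4) (k : ℤ), 1 ≤ k → 0 ≤ X i k t) :
    ∀ m : ℕ, ∀ t ∈ Icc (0 : ℝ) s,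
      ∫ τ in (0 : ℝ)..t, (1 + ε₀) ^ ((5 : ℝ) * (m : ℝ) / 2) *
          ∑ i, ∑ j, α i i j (0, 0, 1) * X i (m : ℤ) τ ^ 2 * X j ((m : ℤ) + 1) τ ≤
        (∑ i, (1 / 2 : ℝ) * X₀ i ^ 2) * ((1 + ρ * κ)⁻¹) ^ m := by
  have hr : 0 < 1 + ρ * κ := by positivity
  have hb : (0 : ℝ) < 1 + ε₀ := by linarith
  intro m
  induction m with
  | zero =>
    intro t ht
    have h := kpProper_bondFlux_budget hs hc hO hD hb hν hdat hvan hXc hode 0 t ht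
    simpa using h
  | succ m ih =>
    intro t ht
    have hstep := sharedPocket_flux_step hs hc hO hD hw3 h3w hPump hP33 hCz hε hν hρ0 hκ0 hPnn hρ hκ hdat hXc hode hnn
      (n := (m : ℤ) + 1) (by omega) t ht
    -- the in-gate of shell `m+1` is the out-gate of shell `m`
    have hin : ∫ τ in (0 : ℝ)..t, (1 + ε₀) ^ ((5 : ℝ) * ((((m : ℤ) + 1 : ℤ) : ℝ) - 1) / 2) *
          ∑ i, ∑ a, α a a i (0, 0, 1) * X a ((m : ℤ) + 1 - 1) τ ^ 2 * X i ((m : ℤ) + 1) τ =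
        ∫ τ in (0 : ℝ)..t, (1 + ε₀) ^ ((5 : ℝ) * (m : ℝ) / 2) *
          ∑ i, ∑ j, α i i j (0, 0, 1) * X i (m : ℤ) τ ^ 2 * X j ((m : ℤ) + 1) τ := by
      refine intervalIntegral.integral_congr fun τ _ => ?_
      have h := (kpProper_outFlux_eq_inFlux_succ (α := α) ε₀ X (m : ℤ) τ).symm
      have hc' : ((5 : ℝ) * (((m : ℤ) : ℤ) : ℝ) / 2) = (5 : ℝ) * (m : ℝ) / 2 := by push_cast; ring
      simpa [hc'] using h
    rw [hin] at hstep
    have hih := ih t ht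
    have hcast1 : (((m + 1 : ℕ) : ℝ)) = (((m : ℤ) + 1 : ℤ) : ℝ) := by push_cast; ring
    have hcast2 : (((m + 1 : ℕ) : ℤ)) = (m : ℤ) + 1 := by push_cast; ring
    rw [hcast1, hcast2, pow_succ]
    have h2 : ∫ τ in (0 : ℝ)..t, (1 + ε₀) ^ ((5 : ℝ) * (((m : ℤ) + 1 : ℤ) : ℝ) / 2) *
          ∑ i, ∑ j, α i i j (0, 0, 1) * X i ((m : ℤ) + 1) τ ^ 2 * X j ((m : ℤ) + 1 + 1) τ ≤
        (∫ τ in (0 : ℝ)..t, (1 + ε₀) ^ ((5 : ℝ) * (m : ℝ) / 2) *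
          ∑ i, ∑ j, α i i j (0, 0, 1) * X i (m : ℤ) τ ^ 2 * X j ((m : ℤ) + 1) τ) * (1 + ρ * κ)⁻¹ := by
      rw [le_mul_inv_iff₀ hr, mul_comm]
      exact hstep
    calc _ ≤ _ := h2
      _ ≤ (∑ i, (1 / 2 : ℝ) * X₀ i ^ 2) * ((1 + ρ * κ)⁻¹) ^ m * (1 + ρ * κ)⁻¹ :=
          mul_le_mul_of_nonneg_right hih (inv_nonneg.2 hr.le)
      _ = _ := by ring

end SharedPocketFlux

/-! ## The barrier -/

/-- **ENERGY STARVATION BARRIER, CLASS-WIDE FORM (shared pocket).**  For every KP network proper `α ∈ E₂(R)` of the shared-pocket class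
(live modes `0,1,2` with any diagonal forward network among them, every live mode pumping in-shell into the dead-end pocket `3` with weight
`P a ≥ 0`, `P 3 = 0`, the pocket neither fed nor feeding forward, no differential triads) and all `ρ, κ ≥ 0` with `ρ·w_{ae} ≤ P a`,
`κ·Σ_e w_{ae} ≤ P a` and `ρκ > ε₀`: `ShellBarrierAt R ε₀ α` with `(1+ε₀)^{2θ} = 1 + ρκ`, `D = 1 + ρκ`, at EVERY scale ratio `1 + ε₀ > 1`.
MODEL lattice statement; a corner of the registered stubs, not the stubs. [cite: Tao2016AveragedNS, §4 (4.13)] -/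
theorem sharedPocket_shellBarrierAt {α : Fin 4 → Fin 4 → Fin 4 → ℤ × ℤ × ℤ → ℝ} {P : Fin 4 → ℝ} {ε₀ ρ κ : ℝ}
    (hε : 0 < ε₀) (hρ0 : 0 ≤ ρ) (hκ0 : 0 ≤ κ) (hPnn : ∀ a, 0 ≤ P a) (hgap : ε₀ < ρ * κ)
    (hρ : ∀ a e : Fin 4, ρ * α a a e (0, 0, 1) ≤ P a) (hκ : ∀ a : Fin 4, κ * ∑ e, α a a e (0, 0, 1) ≤ P a)
    (hD : ∀ a b i : Fin 4, a ≠ b → α a b i (0, 0, 1) = 0)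
    (hw3 : ∀ a : Fin 4, α a a 3 (0, 0, 1) = 0) (h3w : ∀ e : Fin 4, α 3 3 e (0, 0, 1) = 0)
    (hPump : ∀ a d : Fin 4, a ≠ d → α a a d (0, 0, 0) = if d = 3 then P a else 0) (hP33 : P 3 = 0)
    (hCz : ∀ a b d : Fin 4, a ≠ b → a ≠ d → b ≠ d → α a b d (0, 0, 0) = 0) (R : ℝ) :
    ShellBarrierAt R ε₀ α := by
  intro hT hO
  have hs : IsSymmetricCoeff α := hT.1
  have hc : IsCancellingCoeff α := hT.2.1
  set r : ℝ := ρ * κ with hr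
  have hr0 : 0 < 1 + r := by positivity
  have hb1 : (1 : ℝ) < 1 + ε₀ := by linarith
  have hb0 : (0 : ℝ) < 1 + ε₀ := by linarith
  have hrb : 1 + ε₀ < 1 + r := by simp only [hr]; linarith
  set θ : ℝ := Real.logb (1 + ε₀) (1 + r) / 2 with hθ
  have hθhalf : 1 / 2 < θ := by
    have : 1 < Real.logb (1 + ε₀) (1 + r) := by
      rw [Real.lt_logb_iff_rpow_lt hb1 hr0, Real.rpow_one]
      exact hrb
    simp only [hθ]
    linarith
  have hpow : (1 + ε₀) ^ (2 * θ) = 1 + r := by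
    have : 2 * θ = Real.logb (1 + ε₀) (1 + r) := by simp only [hθ]; ring
    rw [this, Real.rpow_logb hb0 hb1.ne' hr0]
  refine ⟨θ, hθhalf, 1 + r, hr0.le, ?_⟩
  intro ν hν X₀ s _hs X hX0 hXneg _hM hXc hXd hXpos t ht i k
  set E₀ : ℝ := ∑ j : Fin 4, (1 / 2 : ℝ) * X₀ j ^ 2 with hE₀
  have hE₀0 : 0 ≤ E₀ := Finset.sum_nonneg fun j _ => by positivity
  have hq1 : (1 + r) * (1 + r)⁻¹ = 1 := mul_inv_cancel₀ hr0.ne'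
  have hshell : ∑ j : Fin 4, (1 / 2 : ℝ) * X j (k : ℤ) t ^ 2 ≤ E₀ * (1 + r) * ((1 + r)⁻¹) ^ k := by
    cases k with
    | zero =>
      have h := kpProper_lowEnergy_le hs hc hO hD hb0 hν.le hX0 hXneg hXc hXd hXpos 0 t ht
      rw [Finset.range_one, Finset.sum_singleton] at h
      have h1 : E₀ ≤ E₀ * (1 + r) * ((1 + r)⁻¹) ^ 0 := by
        rw [pow_zero, mul_one]
        nlinarith
      exact h.trans h1
    | succ m =>
      have hband := kpProper_bandEnergy_le_gateFlux hs hc hO hD hb0 hν.le hX0 hXneg hXc hXd hXpos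
        (m := m) (N := m + 1) (by omega) t ht
      rw [Finset.Icc_self, Finset.sum_singleton] at hband
      have hflux := sharedPocket_flux_le hs hc hO hD hw3 h3w hPump hP33 hCz hε.le hν.le hρ0 hκ0 hPnn hρ hκ hX0 hXneg hXc hXd
        hXpos m t ht
      have heq : E₀ * ((1 + r)⁻¹) ^ m = E₀ * (1 + r) * ((1 + r)⁻¹) ^ (m + 1) := by
        rw [pow_succ, show E₀ * (1 + r) * (((1 + r)⁻¹) ^ m * (1 + r)⁻¹) =
          E₀ * ((1 + r)⁻¹) ^ m * ((1 + r) * (1 + r)⁻¹) by ring, hq1, mul_one]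
      calc ∑ j : Fin 4, (1 / 2 : ℝ) * X j ((m + 1 : ℕ) : ℤ) t ^ 2 ≤ _ := hband
        _ ≤ E₀ * ((1 + r)⁻¹) ^ m := hflux
        _ = _ := heq
  have hsingle : (1 / 2 : ℝ) * X i (k : ℤ) t ^ 2 ≤ ∑ j : Fin 4, (1 / 2 : ℝ) * X j (k : ℤ) t ^ 2 :=
    Finset.single_le_sum (f := fun j => (1 / 2 : ℝ) * X j (k : ℤ) t ^ 2) (fun j _ => by positivity)
      (Finset.mem_univ i)
  have hweight : (1 + ε₀) ^ (2 * θ * (k : ℝ)) = (1 + r) ^ k := by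
    rw [Real.rpow_mul hb0.le, hpow, Real.rpow_natCast]
  rw [hweight]
  calc (1 + r) ^ k * ((1 / 2 : ℝ) * X i (k : ℤ) t ^ 2) ≤ (1 + r) ^ k * (E₀ * (1 + r) * ((1 + r)⁻¹) ^ k) :=
        mul_le_mul_of_nonneg_left (hsingle.trans hshell) (pow_nonneg hr0.le k)
    _ = (1 + r) * E₀ := by
        rw [show (1 + r) ^ k * (E₀ * (1 + r) * ((1 + r)⁻¹) ^ k) =
          (1 + r) * E₀ * ((1 + r) * (1 + r)⁻¹) ^ k by rw [mul_pow]; ring, hq1, one_pow, mul_one]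

/-- **Tail ceiling** for the shared-pocket class (`CeilingAt R ε₀ α`). MODEL lattice statement. [cite: Tao2016AveragedNS, §4 (4.13)] -/
theorem sharedPocket_ceilingAt {α : Fin 4 → Fin 4 → Fin 4 → ℤ × ℤ × ℤ → ℝ} {P : Fin 4 → ℝ} {ε₀ ρ κ : ℝ}
    (hε : 0 < ε₀) (hρ0 : 0 ≤ ρ) (hκ0 : 0 ≤ κ) (hPnn : ∀ a, 0 ≤ P a) (hgap : ε₀ < ρ * κ)
    (hρ : ∀ a e : Fin 4, ρ * α a a e (0, 0, 1) ≤ P a) (hκ : ∀ a : Fin 4, κ * ∑ e, α a a e (0, 0, 1) ≤ P a)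
    (hD : ∀ a b i : Fin 4, a ≠ b → α a b i (0, 0, 1) = 0)
    (hw3 : ∀ a : Fin 4, α a a 3 (0, 0, 1) = 0) (h3w : ∀ e : Fin 4, α 3 3 e (0, 0, 1) = 0)
    (hPump : ∀ a d : Fin 4, a ≠ d → α a a d (0, 0, 0) = if d = 3 then P a else 0) (hP33 : P 3 = 0)
    (hCz : ∀ a b d : Fin 4, a ≠ b → a ≠ d → b ≠ d → α a b d (0, 0, 0) = 0) (R : ℝ) :
    CeilingAt R ε₀ α :=
  subOnsagerCeiling_ceilingAt_of_shellBarrierAt hε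
    (sharedPocket_shellBarrierAt hε hρ0 hκ0 hPnn hgap hρ hκ hD hw3 h3w hPump hP33 hCz R)

/-- **The registered stubs' currency**: the body of the skeleton's `PrimaryGradedAt R ε₀ α` (verbatim) for every shared-pocket network with
`ρκ > ε₀`, at every scale ratio. MODEL lattice statement; a corner of BOTH registered stubs, not the stubs. [cite: Tao2016AveragedNS, §4 (4.13)] -/
theorem sharedPocket_primaryGraded {α : Fin 4 → Fin 4 → Fin 4 → ℤ × ℤ × ℤ → ℝ} {P : Fin 4 → ℝ} {ε₀ ρ κ : ℝ}
    (hε : 0 < ε₀) (hρ0 : 0 ≤ ρ) (hκ0 : 0 ≤ κ) (hPnn : ∀ a, 0 ≤ P a) (hgap : ε₀ < ρ * κ)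
    (hρ : ∀ a e : Fin 4, ρ * α a a e (0, 0, 1) ≤ P a) (hκ : ∀ a : Fin 4, κ * ∑ e, α a a e (0, 0, 1) ≤ P a)
    (hD : ∀ a b i : Fin 4, a ≠ b → α a b i (0, 0, 1) = 0)
    (hw3 : ∀ a : Fin 4, α a a 3 (0, 0, 1) = 0) (h3w : ∀ e : Fin 4, α 3 3 e (0, 0, 1) = 0)
    (hPump : ∀ a d : Fin 4, a ≠ d → α a a d (0, 0, 0) = if d = 3 then P a else 0) (hP33 : P 3 = 0)
    (hCz : ∀ a b d : Fin 4, a ≠ b → a ≠ d → b ≠ d → α a b d (0, 0, 0) = 0) (R : ℝ) :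
    Literature.Analysis.FluidPDE.TaoCascade.InTableClass R α →
      (∀ (Y : Fin 4 → ℤ → ℝ → ℝ) (τ : ℝ), (∀ (j : Fin 4) (k : ℤ), 1 ≤ k → 0 ≤ Y j k τ) → ∀ δ : ℝ, 0 < δ →
        ∀ (i : Fin 4) (n : ℤ), 1 ≤ n → Y i n τ = 0 → 0 ≤ Literature.Analysis.FluidPDE.TaoCascade.quadTerm δ α Y i n τ) →
      (∀ a b i : Fin 4, a ≠ b → α a b i (0, 0, 1) = 0) →
      ∃ (lev : Fin 4 → ℕ) (L : ℕ), (∀ a, lev a ≤ L) ∧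
        (∀ a, lev a ≠ 0 → (∃ e, α a a e (0, 0, 1) ≠ 0) →
          (∀ j, α j j a (0, 0, 1) ≠ 0 → lev j < lev a ∧ (lev j = 0 ∨ ∃ e', α j j e' (0, 0, 1) ≠ 0)) ∧
          (∀ i₁ i₂, i₁ ≠ a → i₂ ≠ a → α i₁ i₂ a (0, 0, 0) ≠ 0 →
            (lev i₁ < lev a ∧ (lev i₁ = 0 ∨ ∃ e', α i₁ i₁ e' (0, 0, 1) ≠ 0)) ∧
            (lev i₂ < lev a ∧ (lev i₂ = 0 ∨ ∃ e', α i₂ i₂ e' (0, 0, 1) ≠ 0))) ∧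
          (∃ e, α a a e (0, 0, 1) ≠ 0 ∧
            (∀ j, α e e j (0, 0, 1) ≠ 0 → lev j < lev a ∧ (lev j = 0 ∨ ∃ e', α j j e' (0, 0, 1) ≠ 0)) ∧
            (∀ j, j ≠ e → α e e j (0, 0, 0) ≠ 0 →
              lev j < lev a ∧ (lev j = 0 ∨ ∃ e', α j j e' (0, 0, 1) ≠ 0)))) ∧
        ∃ θ : ℝ, 1 / 2 < θ ∧ θ ≤ 1 ∧ ∃ D : ℝ, 0 ≤ D ∧
          ∀ ν : ℝ, 0 < ν → ∀ (X₀ : Fin 4 → ℝ) (s : ℝ), 0 < s → ∀ X : Fin 4 → ℤ → ℝ → ℝ,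
          (∀ (i : Fin 4) (k : ℤ), X i k 0 = if k = 0 then X₀ i else 0) →
          (∀ (i : Fin 4) (k : ℤ), k < 0 → ∀ t : ℝ, X i k t = 0) →
          (∃ M : ℝ, ∀ (t : ℝ) (i : Fin 4) (k : ℤ), (1 + (1 + ε₀) ^ ((10 : ℝ) * k)) * |X i k t| ≤ M) →
          (∀ (i : Fin 4) (k : ℤ), Continuous (X i k)) →
          (∀ (i : Fin 4) (k : ℤ), ∀ t ∈ Set.Icc (0 : ℝ) s, HasDerivWithinAt (X i k)
            (Literature.Analysis.FluidPDE.TaoCascade.quadTerm ε₀ α X i k t - ν * (1 + ε₀) ^ ((2 : ℝ) * k) * X i k t)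
            (Set.Icc (0 : ℝ) s) t) →
          (∀ t ∈ Set.Icc (0 : ℝ) s, ∀ (i : Fin 4) (k : ℤ), 1 ≤ k → 0 ≤ X i k t) →
          ∀ t ∈ Set.Icc (0 : ℝ) s, ∀ i, lev i = 0 → ∀ k : ℕ,
            (1 + ε₀) ^ (2 * θ * (k : ℝ)) * ((1 / 2 : ℝ) * X i (k : ℤ) t ^ 2) ≤
              D * (∑ j : Fin 4, (1 / 2 : ℝ) * X₀ j ^ 2) :=
  kpPrimaryGraded_of_shellBarrierAt hε (sharedPocket_shellBarrierAt hε hρ0 hκ0 hPnn hgap hρ hκ hD hw3 h3w hPump hP33 hCz R)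

end Summit.NavierStokesRegularity.NavierStokesRegularity.Theorems

end
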